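import Summits.QuantumFields.YangMills.Theorems.ConvexGribovBodyBrascampLiebVacuumSCOnelinkHSHelpers

/-!
# Crux `BrascampLiebVacuumSC` (stmt-QuantumFields-16404), line `SketchIdeator1`: helpers for `stub_onelinkHS`, II

The **Haar Poincaré inequality in metric-slope form** on a compact connected group `G` with a faithful
unitary representation `r`: `Var_Haar(φ) ≤ κ(G, r) ∫ slope(φ)² dHaar` for every Frobenius-Lipschitz `φ`
(`onelink_haar_poincare`). Steps: telescoping over a word with Cauchy–Schwarz and right invariance of
Haar measure (`onelink_telescope`); the one-parameter estimate `∫ (φ(g) − φ(g k))² dg ≤ ‖X‖_F² ∫ slope φ² dg`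
for `r.ρ k = exp X`, `exp(ℝ X) ⊆ r.ρ(G)` (subdivision `k = k_n^{n+1}`, `r.ρ k_n = exp(X/(n+1))`, chords
`(n+1)‖exp(X/(n+1)) − 1‖_F → ‖X‖_F`, reverse Fatou) (`onelink_one_parameter`); Jensen and Fubini with the
word decomposition `exists_word`.

References: J. von Neumann, Math. Z. 30 (1929) 3–42; T. Bröcker, T. tom Dieck, *Representations of
Compact Lie Groups* (1985), I (3.11); R. Holley, D. Stroock, J. Stat. Phys. 46 (1987) 1159–1194;
F. Martinelli, *Lectures on Glauber dynamics for discrete spin models*, LNM 1717 (1999), §2.3.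
-/

open scoped BigOperators Topology Matrix ENNReal
open Filter MeasureTheory ProbabilityTheory
open Literature.MathematicalPhysics.QuantumFieldTheory
open Literature.RepresentationTheory.CompactGroups
open Summit.QuantumFields.YangMills.Cruxes.CovarianceBound.SupportWindow
  (froSq coulombF IsCoulMin gluon modeCov supCov wilson4)
open Summit.QuantumFields.YangMills.Theorems.PoincareClustering (hbLaw hbOp)

noncomputable section

namespace Summit.QuantumFields.YangMills.Theorems.BrascampLiebVacuumSC

/-! ### Integration toolkit on the compact group -/

section HaarToolkit

variable {G : Type} [Group G] [TopologicalSpace G] [IsTopologicalGroup G] [CompactSpace G]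
  [MeasurableSpace G] [BorelSpace G]

omit [Group G] [IsTopologicalGroup G] in
/-- A continuous real function on the compact group is integrable for any finite measure. [folklore] -/
theorem onelink_integrable_of_continuous {ψ : G → ℝ} (hψ : Continuous ψ) (μ : Measure G)
    [IsFiniteMeasure μ] : Integrable ψ μ := by
  obtain ⟨B, hB⟩ := isCompact_univ.exists_bound_of_continuousOn hψ.continuousOn
  exact Integrable.of_bound hψ.aestronglyMeasurable B (ae_of_all _ fun x => hB x (Set.mem_univ x))

omit [Group G] [TopologicalSpace G] [IsTopologicalGroup G] [CompactSpace G] [BorelSpace G] in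
/-- Jensen for the square on a probability space: `(∫ u)² ≤ ∫ u²`. [folklore] -/
theorem onelink_sq_integral_le {μ : Measure G} [IsProbabilityMeasure μ] {u : G → ℝ}
    (hu : Integrable u μ) (hu2 : Integrable (fun x => u x ^ 2) μ) :
    (∫ x, u x ∂μ) ^ 2 ≤ ∫ x, u x ^ 2 ∂μ := by
  set c := ∫ x, u x ∂μ with hc
  have h0 : 0 ≤ ∫ x, (u x - c) ^ 2 ∂μ := integral_nonneg fun x => sq_nonneg _
  have hexp : ∀ x, (u x - c) ^ 2 = u x ^ 2 - 2 * c * u x + c ^ 2 := fun x => by ring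
  have h1 : Integrable (fun x => 2 * c * u x) μ := hu.const_mul _
  have h2 : Integrable (fun x => u x ^ 2 - 2 * c * u x) μ := hu2.sub h1
  simp_rw [hexp] at h0
  rw [integral_add h2 (integrable_const _), integral_sub hu2 h1, integral_const_mul, integral_const,
    probReal_univ, one_smul, ← hc] at h0
  nlinarith [h0]

end HaarToolkit

/-! ### The one-parameter estimate and the Haar Poincaré inequality -/

section Poincare

open scoped Matrix.Norms.Operator

variable {G : Type} [Group G] [TopologicalSpace G] [IsTopologicalGroup G] [CompactSpace G]
  [MeasurableSpace G] [BorelSpace G] (r : LatticeRep G)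

/-- **Telescoping**: `∫ (φ(g) − φ(g k_0 ⋯ k_{m-1}))² dg ≤ m ∑_i ∫ (φ(g) − φ(g k_i))² dg`
(Cauchy–Schwarz and right invariance of Haar measure). [folklore] -/
theorem onelink_telescope {φ : G → ℝ} (hφ : Continuous φ) (ks : ℕ → G) (m : ℕ) :
    ∫ g, (φ g - φ (g * ((List.range m).map ks).prod)) ^ 2 ∂haarProbability G ≤
      m * ∑ i ∈ Finset.range m, ∫ g, (φ g - φ (g * ks i)) ^ 2 ∂haarProbability G := by
  set pp : ℕ → G := fun i => ((List.range i).map ks).prod with hpp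
  have hpt : ∀ g : G, (φ g - φ (g * pp m)) ^ 2 ≤
      m * ∑ i ∈ Finset.range m, (φ (g * pp i) - φ (g * pp i * ks i)) ^ 2 := fun g => by
    have htel : φ g - φ (g * pp m) =
        ∑ i ∈ Finset.range m, (φ (g * pp i) - φ (g * pp i * ks i)) := by
      have h := Finset.sum_range_sub' (fun i => φ (g * pp i)) m
      simp only [hpp, pp_zero, mul_one] at h
      rw [hpp, ← h]
      refine Finset.sum_congr rfl fun i _ => ?_
      rw [pp_succ, mul_assoc]
    rw [htel]
    have := sq_sum_le_card_mul_sum_sq (s := Finset.range m)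
      (f := fun i => φ (g * pp i) - φ (g * pp i * ks i))
    rwa [Finset.card_range] at this
  have hci : ∀ i, Continuous fun g : G => (φ (g * pp i) - φ (g * pp i * ks i)) ^ 2 := fun i =>
    ((hφ.comp (continuous_id.mul continuous_const)).sub
      (hφ.comp ((continuous_id.mul continuous_const).mul continuous_const))).pow 2
  have hint : ∀ i ∈ Finset.range m,
      Integrable (fun g : G => (φ (g * pp i) - φ (g * pp i * ks i)) ^ 2) (haarProbability G) :=
    fun i _ => onelink_integrable_of_continuous (hci i) _
  calc ∫ g, (φ g - φ (g * pp m)) ^ 2 ∂haarProbability G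
      ≤ ∫ g, m * ∑ i ∈ Finset.range m, (φ (g * pp i) - φ (g * pp i * ks i)) ^ 2
          ∂haarProbability G := by
        refine integral_mono (onelink_integrable_of_continuous
          ((hφ.sub (hφ.comp (continuous_id.mul continuous_const))).pow 2) _)
          ((integrable_finsetSum _ hint).const_mul _) hpt
    _ = m * ∑ i ∈ Finset.range m, ∫ g, (φ g - φ (g * ks i)) ^ 2 ∂haarProbability G := by
        rw [integral_const_mul, integral_finsetSum _ hint]
        congr 1
        refine Finset.sum_congr rfl fun i _ => ?_
        exact integral_mul_right_eq_self (μ := haarProbability G)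
          (fun x => (φ x - φ (x * ks i)) ^ 2) (pp i)

omit [IsTopologicalGroup G] [CompactSpace G] [MeasurableSpace G] [BorelSpace G] in
/-- The chord `n ‖exp(X/n) − 1‖_F` tends to `‖X‖_F`. [folklore] -/
theorem onelink_tendsto_chord (X : Matrix (Fin r.N) (Fin r.N) ℂ) :
    Tendsto (fun n : ℕ => ((n : ℝ) + 1) * frobNorm (NormedSpace.exp ((1 / ((n : ℝ) + 1)) • X) - 1))
      atTop (𝓝 (frobNorm X)) := by
  have hder : HasDerivAt (fun t : ℝ => NormedSpace.exp (t • X)) X 0 := by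
    have h := hasDerivAt_exp_smul_const (𝕂 := ℝ) X (0 : ℝ)
    simp only [zero_smul, NormedSpace.exp_zero, one_mul] at h
    exact h
  have hsl := hasDerivAt_iff_tendsto_slope.1 hder
  have ht : Tendsto (fun n : ℕ => 1 / ((n : ℝ) + 1)) atTop (𝓝[≠] 0) :=
    tendsto_nhdsWithin_iff.2 ⟨tendsto_one_div_add_atTop_nhds_zero_nat,
      Eventually.of_forall fun n => one_div_ne_zero (Nat.cast_add_one_ne_zero n)⟩
  have h2 := (onelink_continuous_frobNorm.tendsto X).comp (hsl.comp ht)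
  refine h2.congr fun n => ?_
  simp only [Function.comp_apply, slope_def_module, sub_zero, zero_smul, NormedSpace.exp_zero]
  rw [onelink_frobNorm_real_smul, one_div, inv_inv, abs_of_pos (Nat.cast_add_one_pos n)]

omit [IsTopologicalGroup G] [MeasurableSpace G] [BorelSpace G] in
/-- For `X ≠ 0` and `r.ρ k_n = exp(X/(n+1))`: `g k_n → g` with `g k_n ≠ g` eventually. [folklore] -/
theorem onelink_tendsto_mul_kn {X : Matrix (Fin r.N) (Fin r.N) ℂ} (hX0 : X ≠ 0) {kn : ℕ → G}
    (hkn : ∀ n : ℕ, r.ρ (kn n) = NormedSpace.exp ((1 / ((n : ℝ) + 1)) • X)) (g : G) :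
    Tendsto (fun n => g * kn n) atTop (𝓝[≠] g) := by
  have htX : Tendsto (fun n : ℕ => (1 / ((n : ℝ) + 1)) • X) atTop (𝓝 0) := by
    have := (tendsto_one_div_add_atTop_nhds_zero_nat (𝕜 := ℝ)).smul_const X
    rwa [zero_smul] at this
  refine tendsto_nhdsWithin_iff.2 ⟨?_, ?_⟩
  · rw [(r.continuous.isClosedEmbedding r.injective).isEmbedding.tendsto_nhds_iff]
    have hexp : Tendsto (fun n : ℕ => NormedSpace.exp ((1 / ((n : ℝ) + 1)) • X)) atTop (𝓝 1) := by
      have := (NormedSpace.exp_continuous.tendsto (0 : Matrix (Fin r.N) (Fin r.N) ℂ)).comp htX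
      rwa [NormedSpace.exp_zero] at this
    have h := (tendsto_const_nhds (x := r.ρ g)).mul hexp
    rw [mul_one] at h
    refine h.congr fun n => ?_
    simp only [Function.comp_apply, map_mul, hkn]
  · obtain ⟨ρ0, hρ0, hinj⟩ := MatrixLie.exists_ball_injOn_exp (ι := Fin r.N)
    have hev : ∀ᶠ n : ℕ in atTop, (1 / ((n : ℝ) + 1)) • X ∈ Metric.ball (0 : Matrix (Fin r.N)
        (Fin r.N) ℂ) ρ0 :=
      htX (Metric.ball_mem_nhds 0 hρ0)
    filter_upwards [hev] with n hn
    intro hg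
    have hk1 : kn n = 1 := mul_left_cancel (a := g) (by rw [mul_one]; exact hg)
    have he : NormedSpace.exp ((1 / ((n : ℝ) + 1)) • X) = NormedSpace.exp 0 := by
      rw [← hkn n, hk1, map_one, NormedSpace.exp_zero]
    have h0 := hinj hn (Metric.mem_ball_self hρ0) he
    rw [smul_eq_zero] at h0
    rcases h0 with h0 | h0
    · exact one_div_ne_zero (Nat.cast_add_one_ne_zero n) h0
    · exact hX0 h0

/-- **The one-parameter estimate**: for `r.ρ k = exp X` with `exp(ℝ X) ⊆ r.ρ(G)` and a
Frobenius-Lipschitz `φ`, `∫ (φ(g) − φ(g k))² dg ≤ ‖X‖_F² ∫ slope(φ)² dg` (subdivision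
`k = k_n^{n}`, telescoping, reverse Fatou). [folklore] -/
theorem onelink_one_parameter {φ : G → ℝ} {K : ℝ} (hK : 0 ≤ K)
    (hφ : ∀ g h, |φ g - φ h| ≤ K * frobNorm (r.ρ g - r.ρ h))
    {X : Matrix (Fin r.N) (Fin r.N) ℂ} (hX : ∀ t : ℝ, ∃ kt : G, r.ρ kt = NormedSpace.exp (t • X))
    {k : G} (hk : r.ρ k = NormedSpace.exp X) :
    ENNReal.ofReal (∫ g, (φ g - φ (g * k)) ^ 2 ∂haarProbability G) ≤
      ENNReal.ofReal (frobNorm X ^ 2) * ∫⁻ g, (limsup (fun h => ENNReal.ofReal (|φ h - φ g| /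
          Real.sqrt (froSq (r.ρ h - r.ρ g)))) (𝓝[≠] g)) ^ 2 ∂haarProbability G := by
  have hφc : Continuous φ := onelink_continuous_of_lip r hφ
  -- the trivial case `X = 0`
  by_cases hX0 : X = 0
  · have hk1 : k = 1 := r.injective (by rw [hk, hX0, NormedSpace.exp_zero, map_one])
    simp [hk1]
  -- subdivision points `k_n`, `ρ k_n = exp (X/(n+1))`, `k_n^{n+1} = k`
  choose kn hkn using fun n : ℕ => hX (1 / ((n : ℝ) + 1))
  have hpow : ∀ n : ℕ, kn n ^ (n + 1) = k := fun n => r.injective (by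
    rw [map_pow, hkn, hk, ← MatrixLie.exp_natCast_smul, smul_smul, Nat.cast_add_one,
      mul_one_div_cancel (Nat.cast_add_one_ne_zero n), one_smul])
  -- the chord lengths `c n = (n+1) ‖ρ k_n - 1‖_F → ‖X‖_F`, bounded by `C`
  set c : ℕ → ℝ := fun n => ((n : ℝ) + 1) * frobNorm (r.ρ (kn n) - r.ρ 1) with hc_def
  have hc : Tendsto c atTop (𝓝 (frobNorm X)) := by
    refine (onelink_tendsto_chord r X).congr fun n => ?_
    simp only [hc_def, hkn, map_one]
  have hc0 : ∀ n, 0 ≤ c n := fun n => mul_nonneg (Nat.cast_add_one_pos n).le (frobNorm_nonneg _)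
  obtain ⟨C, hC⟩ := (hc.isBoundedUnder_le).bddAbove_range
  have hCn : ∀ n, c n ≤ C := fun n => hC ⟨n, rfl⟩
  have hC0 : 0 ≤ C := (hc0 0).trans (hCn 0)
  -- the approximants `F n g = ((n+1) |φ g - φ (g k_n)|)²`
  set a : ℕ → G → ℝ := fun n g => ((n : ℝ) + 1) * |φ g - φ (g * kn n)| with ha_def
  have ha0 : ∀ n g, 0 ≤ a n g := fun n g => mul_nonneg (Nat.cast_add_one_pos n).le (abs_nonneg _)
  have hdist : ∀ n g, frobNorm (r.ρ (g * kn n) - r.ρ g) = frobNorm (r.ρ (kn n) - r.ρ 1) := fun n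
      g => by
    conv_lhs => rw [← mul_one g, mul_assoc, one_mul]
    exact onelink_frobNorm_mul_left r g (kn n) 1
  have ha_le : ∀ n g, a n g ≤ K * C := fun n g => by
    have h1 : |φ g - φ (g * kn n)| ≤ K * frobNorm (r.ρ (kn n) - r.ρ 1) := by
      rw [abs_sub_comm, ← hdist n g]; exact hφ _ _
    calc a n g ≤ ((n : ℝ) + 1) * (K * frobNorm (r.ρ (kn n) - r.ρ 1)) :=
          mul_le_mul_of_nonneg_left h1 (Nat.cast_add_one_pos n).le
      _ = K * c n := by rw [hc_def]; ring
      _ ≤ K * C := mul_le_mul_of_nonneg_left (hCn n) hK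
  have ha_eq : ∀ n g, a n g =
      |φ (g * kn n) - φ g| / Real.sqrt (froSq (r.ρ (g * kn n) - r.ρ g)) * c n := fun n g => by
    by_cases h1 : kn n = 1
    · simp [ha_def, hc_def, h1]
    · have hpos : 0 < frobNorm (r.ρ (kn n) - r.ρ 1) := onelink_frobNorm_sub_pos r h1
      rw [onelink_sqrt_froSq, hdist, ha_def, hc_def, abs_sub_comm]
      field_simp
  have hac : ∀ n, Continuous (a n) := fun n =>
    continuous_const.mul ((hφc.sub (hφc.comp (continuous_id.mul continuous_const))).abs)
  set F : ℕ → G → ℝ≥0∞ := fun n g => ENNReal.ofReal (a n g ^ 2) with hF_def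
  have hFm : ∀ n, Measurable (F n) := fun n => ((hac n).pow 2).measurable.ennreal_ofReal
  have hFb : ∀ n, F n ≤ᵐ[haarProbability G] fun _ => ENNReal.ofReal ((K * C) ^ 2) := fun n =>
    ae_of_all _ fun g => ENNReal.ofReal_le_ofReal (pow_le_pow_left₀ (ha0 n g) (ha_le n g) 2)
  -- Step 1: `ofReal (∫ (φ g - φ (g k))²) ≤ ∫⁻ F n` for every `n`
  have hstep1 : ∀ n, ENNReal.ofReal (∫ g, (φ g - φ (g * k)) ^ 2 ∂haarProbability G) ≤
      ∫⁻ g, F n g ∂haarProbability G := fun n => by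
    have htel := onelink_telescope hφc (fun _ => kn n) (n + 1)
    rw [pp_const, hpow n, Finset.sum_const, Finset.card_range, nsmul_eq_mul, ← mul_assoc] at htel
    have hI : Integrable (fun g => a n g ^ 2) (haarProbability G) :=
      onelink_integrable_of_continuous ((hac n).pow 2) _
    rw [hF_def, ← ofReal_integral_eq_lintegral_ofReal hI (ae_of_all _ fun g => sq_nonneg _)]
    refine ENNReal.ofReal_le_ofReal (htel.trans (le_of_eq ?_))
    rw [← integral_const_mul]
    refine integral_congr_ae (ae_of_all _ fun g => ?_)
    simp only [ha_def]
    rw [mul_pow, sq_abs]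
    push_cast
    ring
  -- Step 2: reverse Fatou
  have hfatou := limsup_lintegral_le (μ := haarProbability G) (fun _ => ENNReal.ofReal ((K * C) ^
      2))
    hFm hFb (by simp)
  -- Step 3: the pointwise `limsup`
  have hpt : ∀ g, limsup (fun n => F n g) atTop ≤
      ENNReal.ofReal (frobNorm X ^ 2) * (limsup (fun h => ENNReal.ofReal (|φ h - φ g| / Real.sqrt
          (froSq (r.ρ h - r.ρ g)))) (𝓝[≠] g)) ^ 2 := fun g => by
    have hu : limsup (fun n => ENNReal.ofReal
        (|φ (g * kn n) - φ g| / Real.sqrt (froSq (r.ρ (g * kn n) - r.ρ g)))) atTop ≤ (limsup (fun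
            h => ENNReal.ofReal (|φ h - φ g| / Real.sqrt (froSq (r.ρ h - r.ρ g)))) (𝓝[≠] g)) :=
      limsup_seq_le_eslope r φ g (onelink_tendsto_mul_kn r hX0 hkn g)
    have hu_top : limsup (fun n => ENNReal.ofReal
        (|φ (g * kn n) - φ g| / Real.sqrt (froSq (r.ρ (g * kn n) - r.ρ g)))) atTop ≠ ∞ :=
      ne_top_of_le_ne_top ENNReal.ofReal_ne_top
        ((hu.trans (eslope_le r hK hφ g)))
    have hv : limsup (fun n => ENNReal.ofReal (c n)) atTop = ENNReal.ofReal (frobNorm X) :=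
      (ENNReal.tendsto_ofReal hc).limsup_eq
    have hav : limsup (fun n => ENNReal.ofReal (a n g)) atTop ≤
        (limsup (fun h => ENNReal.ofReal (|φ h - φ g| / Real.sqrt (froSq (r.ρ h - r.ρ g)))) (𝓝[≠]
            g)) * ENNReal.ofReal (frobNorm X) := by
      have heq : (fun n => ENNReal.ofReal (a n g)) =
          (fun n => ENNReal.ofReal
            (|φ (g * kn n) - φ g| / Real.sqrt (froSq (r.ρ (g * kn n) - r.ρ g)))) *
            fun n => ENNReal.ofReal (c n) := by
        funext n
        simp only [Pi.mul_apply, ha_eq, ENNReal.ofReal_mul (dq_nonneg r φ g _)]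
      rw [heq]
      refine (ENNReal.limsup_mul_le' (Or.inr (by rw [hv]; exact ENNReal.ofReal_ne_top))
        (Or.inl hu_top)).trans ?_
      rw [hv]
      exact mul_le_mul_left hu _
    have ha_top : limsup (fun n => ENNReal.ofReal (a n g)) atTop ≠ ∞ :=
      ne_top_of_le_ne_top (ENNReal.mul_ne_top (eslope_lt_top r hK hφ g).ne ENNReal.ofReal_ne_top)
          hav
    have hsq : limsup (fun n => F n g) atTop ≤ (limsup (fun n => ENNReal.ofReal (a n g)) atTop) ^
        2 := by
      have heq : (fun n => F n g) =
          (fun n => ENNReal.ofReal (a n g)) * fun n => ENNReal.ofReal (a n g) := by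
        funext n
        simp only [Pi.mul_apply, hF_def, sq, ENNReal.ofReal_mul (ha0 n g)]
      rw [heq, sq]
      exact ENNReal.limsup_mul_le' (Or.inr ha_top) (Or.inl ha_top)
    calc limsup (fun n => F n g) atTop ≤ (limsup (fun n => ENNReal.ofReal (a n g)) atTop) ^ 2 := hsq
      _ ≤ ((limsup (fun h => ENNReal.ofReal (|φ h - φ g| / Real.sqrt (froSq (r.ρ h - r.ρ g))))
          (𝓝[≠] g)) * ENNReal.ofReal (frobNorm X)) ^ 2 := pow_le_pow_left' hav 2
      _ = ENNReal.ofReal (frobNorm X ^ 2) * (limsup (fun h => ENNReal.ofReal (|φ h - φ g| /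
          Real.sqrt (froSq (r.ρ h - r.ρ g)))) (𝓝[≠] g)) ^ 2 := by
          rw [mul_pow, ENNReal.ofReal_pow (frobNorm_nonneg X), mul_comm]
  -- assemble
  calc ENNReal.ofReal (∫ g, (φ g - φ (g * k)) ^ 2 ∂haarProbability G)
      ≤ limsup (fun n => ∫⁻ g, F n g ∂haarProbability G) atTop :=
        le_limsup_of_frequently_le (Frequently.of_forall hstep1) (by isBoundedDefault)
    _ ≤ ∫⁻ g, limsup (fun n => F n g) atTop ∂haarProbability G := hfatou
    _ ≤ ∫⁻ g, ENNReal.ofReal (frobNorm X ^ 2) * (limsup (fun h => ENNReal.ofReal (|φ h - φ g| /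
        Real.sqrt (froSq (r.ρ h - r.ρ g)))) (𝓝[≠] g)) ^ 2 ∂haarProbability G := lintegral_mono hpt
    _ = ENNReal.ofReal (frobNorm X ^ 2) * ∫⁻ g, (limsup (fun h => ENNReal.ofReal (|φ h - φ g| /
        Real.sqrt (froSq (r.ρ h - r.ρ g)))) (𝓝[≠] g)) ^ 2 ∂haarProbability G :=
        lintegral_const_mul' _ _ ENNReal.ofReal_ne_top

/-- **Haar Poincaré inequality in metric-slope form** on a compact connected group with a faithful
unitary representation: `Var_Haar(φ) ≤ κ ∫ slope(φ)² dHaar` for every Frobenius-Lipschitz `φ`, with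
`κ = m² + 1`, `m` the word length of `exists_word` (Jensen, Fubini, telescoping over the word, and the
one-parameter estimate). [folklore] -/
theorem onelink_haar_poincare [ConnectedSpace G] [SecondCountableTopology G] :
    ∃ κ : ℝ, 0 ≤ κ ∧ ∀ (φ : G → ℝ) (K : ℝ), 0 ≤ K →
      (∀ g h, |φ g - φ h| ≤ K * frobNorm (r.ρ g - r.ρ h)) →
      ENNReal.ofReal (∫ g, (φ g - ∫ h, φ h ∂haarProbability G) ^ 2 ∂haarProbability G) ≤
        ENNReal.ofReal κ * ∫⁻ g, (limsup (fun h => ENNReal.ofReal (|φ h - φ g| / Real.sqrt (froSq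
            (r.ρ h - r.ρ g)))) (𝓝[≠] g)) ^ 2 ∂haarProbability G := by
  obtain ⟨m, hm⟩ := exists_word r
  refine ⟨(m : ℝ) ^ 2 + 1, by positivity, fun φ K hK hφ => ?_⟩
  set μ := haarProbability G with hμ
  set I := ∫⁻ g, (limsup (fun h => ENNReal.ofReal (|φ h - φ g| / Real.sqrt (froSq (r.ρ h - r.ρ
      g)))) (𝓝[≠] g)) ^ 2 ∂μ with hI
  have hφc : Continuous φ := onelink_continuous_of_lip r hφ
  by_cases hItop : I = ∞
  · rw [hItop, ENNReal.mul_top (ENNReal.ofReal_pos.2 (by positivity)).ne']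
    exact le_top
  -- the word bound: `∫ (φ g - φ (g k))² ≤ m² I` for every `k`
  have hD : ∀ k : G, ∫ g, (φ g - φ (g * k)) ^ 2 ∂μ ≤ (m : ℝ) ^ 2 * I.toReal := fun k => by
    obtain ⟨ks, hks, hX⟩ := hm k
    have htel := onelink_telescope hφc ks m
    rw [hks] at htel
    refine htel.trans ?_
    have hterm : ∀ i ∈ Finset.range m, ∫ g, (φ g - φ (g * ks i)) ^ 2 ∂μ ≤ I.toReal := fun i hi => by
      obtain ⟨X, hXt, hX1, hXe⟩ := hX i (Finset.mem_range.1 hi)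
      have h1 := onelink_one_parameter r hK hφ hXt hXe.symm
      have h2 : ENNReal.ofReal (frobNorm X ^ 2) * I ≤ I := by
        calc ENNReal.ofReal (frobNorm X ^ 2) * I ≤ 1 * I := by
              refine mul_le_mul_left ?_ _
              rw [← ENNReal.ofReal_one]
              exact ENNReal.ofReal_le_ofReal (by nlinarith [frobNorm_nonneg X])
          _ = I := one_mul I
      exact (ENNReal.ofReal_le_iff_le_toReal hItop).1 (h1.trans h2)
    calc (m : ℝ) * ∑ i ∈ Finset.range m, ∫ g, (φ g - φ (g * ks i)) ^ 2 ∂μ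
        ≤ (m : ℝ) * ∑ _i ∈ Finset.range m, I.toReal :=
          mul_le_mul_of_nonneg_left (Finset.sum_le_sum hterm) (Nat.cast_nonneg m)
      _ = (m : ℝ) ^ 2 * I.toReal := by
          rw [Finset.sum_const, Finset.card_range, nsmul_eq_mul]; ring
  -- Jensen and Fubini
  set c := ∫ h, φ h ∂μ with hc
  have hF : Integrable (Function.uncurry fun g k : G => (φ g - φ (g * k)) ^ 2) (μ.prod μ) := by
    have hcont : Continuous (Function.uncurry fun g k : G => (φ g - φ (g * k)) ^ 2) :=
      ((hφc.comp continuous_fst).sub (hφc.comp (continuous_fst.mul continuous_snd))).pow 2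
    obtain ⟨B, hB⟩ := isCompact_univ.exists_bound_of_continuousOn hcont.continuousOn
    exact Integrable.of_bound hcont.aestronglyMeasurable B (ae_of_all _ fun x => hB x
        (Set.mem_univ x))
  have hJ : ∀ g, (φ g - c) ^ 2 ≤ ∫ k, (φ g - φ (g * k)) ^ 2 ∂μ := fun g => by
    have hck : Continuous fun k : G => φ (g * k) := hφc.comp (continuous_const.mul continuous_id)
    have hi0 : Integrable (fun k => φ (g * k)) μ := onelink_integrable_of_continuous hck μ
    have hi1 : Integrable (fun k => φ g - φ (g * k)) μ := (integrable_const _).sub hi0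
    have hi2 : Integrable (fun k => (φ g - φ (g * k)) ^ 2) μ :=
      onelink_integrable_of_continuous ((continuous_const.sub hck).pow 2) μ
    have hmean : ∫ k, (φ g - φ (g * k)) ∂μ = φ g - c := by
      rw [integral_sub (integrable_const _) hi0, integral_const, probReal_univ, one_smul, hc]
      congr 1
      exact integral_mul_left_eq_self φ g
    rw [← hmean]
    exact onelink_sq_integral_le hi1 hi2
  have hV : ∫ g, (φ g - c) ^ 2 ∂μ ≤ (m : ℝ) ^ 2 * I.toReal := by
    calc ∫ g, (φ g - c) ^ 2 ∂μ ≤ ∫ g, ∫ k, (φ g - φ (g * k)) ^ 2 ∂μ ∂μ :=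
          integral_mono_of_nonneg (ae_of_all _ fun g => sq_nonneg _) hF.integral_prod_left
            (ae_of_all _ hJ)
      _ = ∫ k, ∫ g, (φ g - φ (g * k)) ^ 2 ∂μ ∂μ := integral_integral_swap hF
      _ ≤ ∫ _k, (m : ℝ) ^ 2 * I.toReal ∂μ :=
          integral_mono_of_nonneg (ae_of_all _ fun k => integral_nonneg fun g => sq_nonneg _)
            (integrable_const _) (ae_of_all _ hD)
      _ = (m : ℝ) ^ 2 * I.toReal := by rw [integral_const, probReal_univ, one_smul]
  calc ENNReal.ofReal (∫ g, (φ g - c) ^ 2 ∂μ) ≤ ENNReal.ofReal ((m : ℝ) ^ 2 * I.toReal) :=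
        ENNReal.ofReal_le_ofReal hV
    _ = ENNReal.ofReal ((m : ℝ) ^ 2) * I := by
        rw [ENNReal.ofReal_mul (by positivity), ENNReal.ofReal_toReal hItop]
    _ ≤ ENNReal.ofReal ((m : ℝ) ^ 2 + 1) * I :=
        mul_le_mul_left (ENNReal.ofReal_le_ofReal (by linarith)) _

/-- **Registered sub-goal of `stub_onelinkHS` (Haar Poincaré inequality in metric-slope form, closed form of
`onelink_haar_poincare`).** For a compact connected second-countable `G` with a faithful unitary lattice
representation `r` there is `κ ≥ 0` with `Var_Haar(φ) ≤ κ ∫ slope(φ)² dHaar` for every Frobenius-Lipschitz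
`φ : G → ℝ` (slope = `limsup_{h → g, h ≠ g} |φ h − φ g| / ‖ρ h − ρ g‖_F`, as an extended real). [folklore] -/
theorem stub_onelinkHS_haarPoincare :
    ∀ (G : Type) [Group G] [TopologicalSpace G] [IsTopologicalGroup G] [CompactSpace G]
    [MeasurableSpace G] [BorelSpace G] [ConnectedSpace G] [SecondCountableTopology G] (r : LatticeRep G),
    ∃ κ : ℝ, 0 ≤ κ ∧ ∀ (φ : G → ℝ) (K : ℝ), 0 ≤ K →
      (∀ g h, |φ g - φ h| ≤ K * frobNorm (r.ρ g - r.ρ h)) →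
      ENNReal.ofReal (∫ g, (φ g - ∫ h, φ h ∂haarProbability G) ^ 2 ∂haarProbability G) ≤
        ENNReal.ofReal κ * ∫⁻ g, (limsup (fun h => ENNReal.ofReal (|φ h - φ g| /
          Real.sqrt (froSq (r.ρ h - r.ρ g)))) (𝓝[≠] g)) ^ 2 ∂haarProbability G :=
  fun _ _ _ _ _ _ _ _ _ r => onelink_haar_poincare r

end Poincare

end Summit.QuantumFields.YangMills.Theorems.BrascampLiebVacuumSC

end
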